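import Mathlib
import HarnessLib
import Literature.MathematicalPhysics.QuantumLattice.HubbardGridSymbolMassGram
import Summits.HubbardSuperconductivity.HubbardSuperconductivity.Theorems.KLProgrammeKLRegimeEngineScaleZeroValuesExplicit
import Summits.HubbardSuperconductivity.HubbardSuperconductivity.Theorems.KLProgrammeKLRegimeEngineV8PairTransferExport

/-!
# K3 ENGINE-FLOW child (stmt-HubbardSuperconductivity-20437 `KLRegimeEngineV17F2`), v2 class #5 at scale `0`, part 1:
# the Gram constant of an admissible SOFT smearing line (`γ = √6047`, β-uniform) and the geometric majorant of the binomial–Gram defect series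

Cell `gate-hubbard-kl`, seat hubbard-kl-k3c2-p1 g5 (scale-`0` lane; plan g17 (R47p): the `n = 0` bases of the carried invariants of the v2 skeleton are
landed theorems of this lane).  Inputs of `…EngineScaleZeroTransfer` (the smearing transfer `‖𝒱₄(e^{Δ_D}𝒱₀) − 𝒞₀‖ ≤ klTransferC R·U²`):

* §1 **`isGramBoundedR_gridSub_softSubCov_zero`** — every smearing covariance `D` admissible at `(K, 0)` (`IsSoftSubCov`: normal, symbol
  `φ·βL²(iω + e_K)/(ω² + e_K²)`, `0 ≤ φ ≤ 1 − w^K_{e₀}`) is replica-Gram-bounded on the `4M` grid with `γ = √6047`, for every admissible frame and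
  `klBetaMin ≤ β ≤ L`: the Gram constant of a pulled-back normal covariance is the phase-space MASS of its symbol (`HubbardGridSymbolMassGram`), here
  `≤ (βL²)⁻¹Σ(1 − w^K_{e₀})/√(ω² + e_K²) ≤ 6047` (`infraredGram_frame_le`, k3c4-p1) — β-UNIFORM although the line's decay constant is thermal;
* §2 **`sum_ite_choose_graded_le`** — the series majorant: `Σ_{m′ < B} [2 < m′]·C(2m′,4)·γ^{2m′−4}·(ρᵢ^{2m′}·A·θ^{m′−2}) ≤ 80·A·ρᵢ⁴·y`, `y = 4γ²θρᵢ² ≤ 1/2`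
  (`C(2m′,4) ≤ 4^{m′}`; the shape produced by `GrassmannGaussConvBinomialGram.sum_norm_kernel_gaussConv_sub_le_binomial_of_gramBounded` against the graded
  determinant bounds `ρ⁻²ᵐ′·e‖Ṽ‖_h·θ^{m′−2}/(1−θ)` of `GrassmannEffectiveActionGradedDB`).

Nothing about the model is asserted beyond these implications; nothing asserts superconductivity.
-/

noncomputable section

namespace Summit.HubbardSuperconductivity.HubbardSuperconductivity.Theorems.EngineV8

set_option linter.dupNamespace false -- summit = problem name (single-conjunct summit), D-0017

open Real Finset Literature.MathematicalPhysics.QuantumLattice Literature.Probability.LatticeModels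
open Literature.MathematicalPhysics.QuantumLattice.GrassmannAlgebra
open Summit.HubbardSuperconductivity.HubbardSuperconductivity.Theorems.KLRegimeSplit
open Summit.HubbardSuperconductivity.HubbardSuperconductivity.Theorems.KLProgrammeLegKernels
open Summit.HubbardSuperconductivity.HubbardSuperconductivity.Theorems.ScaleZeroDecay

variable {L M : ℕ} [NeZero L]

/-! ## §1 The Gram constant of an admissible soft line at scale `0` -/

/-- `‖(iω + ξ)/(ω² + ξ²)‖ = 1/√(ω² + ξ²)` (also at `ω = ξ = 0`, where both sides vanish). -/
private theorem norm_I_mul_add_div_t (ω ξ : ℝ) :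
    ‖(Complex.I * (ω : ℂ) + (ξ : ℂ)) / (((ω ^ 2 + ξ ^ 2 : ℝ)) : ℂ)‖ = 1 / Real.sqrt (ω ^ 2 + ξ ^ 2) := by
  have hnum : ‖Complex.I * (ω : ℂ) + (ξ : ℂ)‖ = Real.sqrt (ω ^ 2 + ξ ^ 2) := by
    rw [Complex.norm_eq_sqrt_sq_add_sq]
    congr 1
    simp [Complex.add_re, Complex.add_im, Complex.mul_re, Complex.mul_im]
    ring
  rw [norm_div, hnum, Complex.norm_real, Real.norm_eq_abs, abs_of_nonneg (by positivity)]
  by_cases h0 : ω ^ 2 + ξ ^ 2 = 0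
  · rw [h0, Real.sqrt_zero]; simp
  · have hpos : 0 < ω ^ 2 + ξ ^ 2 := lt_of_le_of_ne (by positivity) (Ne.symm h0)
    rw [div_eq_div_iff (by positivity) (Real.sqrt_pos.2 hpos).ne', one_mul, Real.mul_self_sqrt hpos.le]

/-- **Every smearing covariance admissible at `(K, 0)` is replica-Gram-bounded on the `4M` grid with `γ = √6047`**, for every admissible frame
(`FrameOK R U N μ K`) and `klBetaMin ≤ β ≤ L`: its symbol is `φ·βL²(iω + e_K)/(ω² + e_K²)` with `0 ≤ φ ≤ 1 − w^K_{e₀}`, so the phase-space mass of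
`HubbardGridSymbolMassGram` is `≤ (βL²)⁻¹Σ(1 − w^K_{e₀})/√(ω² + e_K²) ≤ 7·1793·e₀ + (e₀ + 8)·704 ≤ 6047` (`infraredGram_frame_le`). -/
theorem isGramBoundedR_gridSub_softSubCov_zero [NeZero M] {R : RenConsts} {U : ℝ} {Nsc : ℕ} {μ : ℝ} {K : TrigPolyC4v}
    (hK : FrameOK R U Nsc μ K) {β : ℝ} (hβ : klBetaMin ≤ β) (hβL : β ≤ L)
    {D : Matrix (HubbardFieldIdx L M) (HubbardFieldIdx L M) ℂ} (hD : IsSoftSubCov L M β μ K 0 D) :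
    IsGramBoundedR ((hubbardGridSub L M β (2 * (2 * M))).transpose * D * hubbardGridSub L M β (2 * (2 * M))) (Real.sqrt 6047) := by
  obtain ⟨φ, hφ, rfl⟩ := hD
  have hβ0 : 0 < β := beta_pos_of_klBetaMin_le hβ
  have hL : (0 : ℝ) < L := by exact_mod_cast Nat.pos_of_ne_zero (NeZero.ne L)
  have hβL2 : 0 < β * (L : ℝ) ^ 2 := by positivity
  have he₀ : (0 : ℝ) < klE0 := by norm_num [klE0]
  have he₀' : klE0 ≤ 3 / 80 := by norm_num [klE0]
  have hπβ : Real.pi / β ≤ klE0 := by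
    rw [div_le_iff₀ hβ0, klE0]
    have h128 : (128 : ℝ) ≤ β := by simpa [klBetaMin] using hβ
    nlinarith [Real.pi_lt_four]
  have hscale : klScale klE0 0 = klE0 := by simp [klScale]
  -- the infrared sum of the frame
  have hsum := infraredGram_frame_le (L := L) (M := M) hK hβ0 he₀ hπβ he₀' hβL
  refine isGramBoundedR_hubbardGridSub_pullback_normalCovariance_of_mass_le β _ _ (Real.sqrt_nonneg _) fun σ => ?_
  rw [Real.sq_sqrt (by norm_num)]
  -- termwise: `‖(βL²)⁻¹‖²·‖p(k,σ)‖ = (βL²)⁻¹·φ/√(ω²+e²) ≤ (βL²)⁻¹·(1 − w)/√(ω²+e²)`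
  have hterm : ∀ k : FreqMomentum L M,
      ‖((1 / (β * (L : ℝ) ^ 2) : ℝ) : ℂ)‖ ^ 2 *
          ‖((φ (k, σ) : ℂ) * (((β * (L : ℝ) ^ 2 : ℝ) : ℂ) *
            ((Complex.I * matsubaraFreq β M k.1 + nambuXiCT L μ K k.2) / nambuDenCT L M β μ 0 K k)))‖ ≤
        1 / (β * (L : ℝ) ^ 2) *
          ((1 - hubbardCutoffWeightCT L M β μ K klE0 k) / Real.sqrt (matsubaraFreq β M k.1 ^ 2 + nambuXiCT L μ K k.2 ^ 2)) := by
    intro k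
    obtain ⟨hφ0, hφ1⟩ := hφ (k, σ)
    rw [hscale] at hφ1
    have hden : (nambuDenCT L M β μ 0 K k : ℝ) = matsubaraFreq β M k.1 ^ 2 + nambuXiCT L μ K k.2 ^ 2 := by rw [nambuDenCT_zero_seed]
    have hsym : ‖(Complex.I * (matsubaraFreq β M k.1 : ℂ) + (nambuXiCT L μ K k.2 : ℂ)) / ((nambuDenCT L M β μ 0 K k : ℝ) : ℂ)‖ =
        1 / Real.sqrt (matsubaraFreq β M k.1 ^ 2 + nambuXiCT L μ K k.2 ^ 2) := by
      rw [hden]; exact norm_I_mul_add_div_t _ _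
    have h1 : ‖((1 / (β * (L : ℝ) ^ 2) : ℝ) : ℂ)‖ = 1 / (β * (L : ℝ) ^ 2) := by
      rw [Complex.norm_real, Real.norm_eq_abs, abs_of_nonneg (by positivity)]
    have h2 : ‖(((β * (L : ℝ) ^ 2 : ℝ)) : ℂ)‖ = β * (L : ℝ) ^ 2 := by
      rw [Complex.norm_real, Real.norm_eq_abs, abs_of_nonneg (by positivity)]
    have h3 : ‖(φ (k, σ) : ℂ)‖ = φ (k, σ) := by rw [Complex.norm_real, Real.norm_eq_abs, abs_of_nonneg hφ0]
    rw [norm_mul, norm_mul, h1, h2, h3, hsym]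
    have hs0 : 0 ≤ 1 / Real.sqrt (matsubaraFreq β M k.1 ^ 2 + nambuXiCT L μ K k.2 ^ 2) := by positivity
    calc (1 / (β * (L : ℝ) ^ 2)) ^ 2 * (φ (k, σ) * (β * (L : ℝ) ^ 2 * (1 / Real.sqrt (matsubaraFreq β M k.1 ^ 2 + nambuXiCT L μ K k.2 ^ 2))))
        = 1 / (β * (L : ℝ) ^ 2) * (φ (k, σ) * (1 / Real.sqrt (matsubaraFreq β M k.1 ^ 2 + nambuXiCT L μ K k.2 ^ 2))) := by
          field_simp
      _ ≤ 1 / (β * (L : ℝ) ^ 2) *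
            ((1 - hubbardCutoffWeightCT L M β μ K klE0 k) * (1 / Real.sqrt (matsubaraFreq β M k.1 ^ 2 + nambuXiCT L μ K k.2 ^ 2))) :=
          mul_le_mul_of_nonneg_left (mul_le_mul_of_nonneg_right hφ1 hs0) (by positivity)
      _ = _ := by ring
  refine (sum_le_sum fun k _ => hterm k).trans ?_
  rw [← mul_sum, one_div, inv_mul_le_iff₀ hβL2]
  refine hsum.trans ?_
  rw [klE0]
  nlinarith

/-! ## §2 The geometric majorant of the binomial–Gram defect series -/

/-- The geometric majorant of the binomial–Gram defect series against graded kernel norms: with `y = 4γ²θρᵢ²`, `y ≤ 1/2`,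
`Σ_{m′ < B} [2 < m′]·C(2m′,4)·γ^{2m′−4}·(ρᵢ^{2m′}·A·θ^{m′−2}) ≤ 80·A·ρᵢ⁴·y` (`C(2m′,4) ≤ 4^{m′}`, three idle `y⁰` terms and `Σ yʲ ≤ 2`). -/
theorem sum_ite_choose_graded_le (B : ℕ) {γ θ ρi A : ℝ} (hγ : 0 ≤ γ) (hθ : 0 ≤ θ) (hρi : 0 ≤ ρi) (hA : 0 ≤ A)
    (hy : 4 * (γ ^ 2 * θ * ρi ^ 2) ≤ 1 / 2) :
    ∑ m' ∈ range B, (if 2 < m' then (((2 * m').choose (2 * 2) : ℕ) : ℝ) * γ ^ (2 * m' - 2 * 2) * (ρi ^ (2 * m') * A * θ ^ (m' - 2)) else 0) ≤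
      80 * A * ρi ^ 4 * (4 * (γ ^ 2 * θ * ρi ^ 2)) := by
  set y : ℝ := 4 * (γ ^ 2 * θ * ρi ^ 2) with hy_def
  have hy0 : 0 ≤ y := by positivity
  -- termwise majorant `16·A·ρi⁴·y·y^{m'-3}`
  have hterm : ∀ m' : ℕ, (if 2 < m' then (((2 * m').choose (2 * 2) : ℕ) : ℝ) * γ ^ (2 * m' - 2 * 2) * (ρi ^ (2 * m') * A * θ ^ (m' - 2))
      else 0) ≤ 16 * A * ρi ^ 4 * y * y ^ (m' - 3) := by
    intro m'
    split_ifs with hm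
    · obtain ⟨j, rfl⟩ : ∃ j, m' = j + 3 := ⟨m' - 3, by omega⟩
      have hch : (((2 * (j + 3)).choose (2 * 2) : ℕ) : ℝ) ≤ (4 : ℝ) ^ (j + 3) := by
        have h := Nat.choose_le_two_pow (2 * (j + 3)) (2 * 2)
        rw [pow_mul] at h
        exact_mod_cast h
      have hrest : 0 ≤ γ ^ (2 * (j + 3) - 2 * 2) * (ρi ^ (2 * (j + 3)) * A * θ ^ (j + 3 - 2)) := by positivity
      calc (((2 * (j + 3)).choose (2 * 2) : ℕ) : ℝ) * γ ^ (2 * (j + 3) - 2 * 2) * (ρi ^ (2 * (j + 3)) * A * θ ^ (j + 3 - 2))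
          ≤ (4 : ℝ) ^ (j + 3) * (γ ^ (2 * (j + 3) - 2 * 2) * (ρi ^ (2 * (j + 3)) * A * θ ^ (j + 3 - 2))) := by
            rw [mul_assoc]; exact mul_le_mul_of_nonneg_right hch hrest
        _ = 16 * A * ρi ^ 4 * y * y ^ (j + 3 - 3) := by
            rw [hy_def, show 2 * (j + 3) - 2 * 2 = 2 * (j + 1) by omega, show j + 3 - 2 = j + 1 by omega,
              show j + 3 - 3 = j by omega, show 2 * (j + 3) = 2 * (j + 1) + 4 by ring]
            ring
    · positivity
  refine (sum_le_sum fun m' _ => hterm m').trans ?_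
  -- `Σ_{m' < B} y^{m'-3} = #{m' < 3} + Σ_{3 ≤ m' < B} y^{m'-3} ≤ 3 + 2`
  have hy1 : y < 1 := by linarith
  have hgeo : ∀ B' : ℕ, ∑ i ∈ range B', y ^ i ≤ 2 := by
    intro B'
    have h := geom_sum_Ico_le_of_lt_one (m := 0) (n := B') hy0 hy1
    rw [range_eq_Ico]
    refine h.trans ?_
    rw [pow_zero, div_le_iff₀ (by linarith)]
    linarith
  have hshift : ∑ m' ∈ range B, y ^ (m' - 3) ≤ 5 := by
    rw [← sum_filter_add_sum_filter_not (range B) (fun m' => m' < 3)]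
    have hlow : ∑ m' ∈ (range B).filter (fun m' => m' < 3), y ^ (m' - 3) ≤ 3 := by
      have hone : ∀ m' ∈ (range B).filter (fun m' => m' < 3), y ^ (m' - 3) = 1 := by
        intro m' hm'
        simp only [mem_filter, mem_range] at hm'
        rw [show m' - 3 = 0 by omega, pow_zero]
      rw [sum_congr rfl hone, sum_const, nsmul_eq_mul, mul_one]
      have hcard : ((range B).filter (fun m' => m' < 3)).card ≤ (range 3).card :=
        card_le_card fun m' hm' => by
          simp only [mem_filter, mem_range] at hm' ⊢
          exact hm'.2
      rw [card_range] at hcard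
      exact_mod_cast hcard
    have hhigh : ∑ m' ∈ (range B).filter (fun m' => ¬ m' < 3), y ^ (m' - 3) ≤ 2 := by
      have hset : (range B).filter (fun m' => ¬ m' < 3) = Ico 3 B := by
        ext m'
        simp only [mem_filter, mem_range, mem_Ico]
        omega
      rw [hset, sum_Ico_eq_sum_range]
      simp only [show ∀ i : ℕ, 3 + i - 3 = i from fun i => by omega]
      exact hgeo _
    linarith
  have htot : ∑ m' ∈ range B, 16 * A * ρi ^ 4 * y * y ^ (m' - 3) = 16 * A * ρi ^ 4 * y * ∑ m' ∈ range B, y ^ (m' - 3) := by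
    rw [mul_sum]
  rw [htot]
  have hc : 0 ≤ 16 * A * ρi ^ 4 * y := by positivity
  nlinarith

end Summit.HubbardSuperconductivity.HubbardSuperconductivity.Theorems.EngineV8

end
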